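import Mathlib.Analysis.InnerProductSpace.PiL2
import Mathlib.MeasureTheory.Measure.Haar.InnerProductSpace
import Mathlib.Analysis.SpecialFunctions.ImproperIntegrals
import Mathlib.MeasureTheory.Group.LIntegral
import HarnessLib

/-!
# The slab integral bound behind velocity averaging

Topic: MathematicalPhysics / KineticTheory. First of the proof files of the `L²` velocity
averaging lemma `Literature.MathematicalPhysics.KineticTheory.velocityAveraging_L2`
(Golse–Lions–Perthame–Sentis 1988; Cercignani–Illner–Pulvirenti 1994, Lemma 5.3.8): the
elementary geometric estimate on which the whole lemma rests (CIP 1994, p. 153–154, the bound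
`λ{ξ ∈ K ; |τ₀ + ξ·z₀| ≤ ε} ≤ Cε` and (3.33)), in the resolvent form used by the proof files:
for a ball `B̄_R` of velocities there is `C = C(R, dim E)` with

  `∫_{B̄_R} dξ / (1 + (c + ⟪ξ, k⟫)²) ≤ C / (1 + |c| + ‖k‖)`   for all `c ∈ ℝ`, `k ∈ E`

(`exists_setLIntegral_closedBall_inv_one_add_sq_inner_le`). For `|c| ≥ 2R‖k‖` the integrand is
`≤ 3/(1+|c|+‖k‖)` pointwise; otherwise one integrates first along the direction of `k`
(an orthonormal basis with `b₀ = k/‖k‖`, `OrthonormalBasis.measurePreserving_repr`,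
`MeasurableEquiv.piFinSuccAbove`), where `∫_ℝ dx/(1+(c+‖k‖x)²) = π/‖k‖`
(`lintegral_inv_one_add_sq_affine`), the remaining coordinates ranging over `[-R, R]`.

## References

* C. Cercignani, R. Illner, M. Pulvirenti, *The Mathematical Theory of Dilute Gases* (1994),
  §5.3, proof of Lemma 5.3.8, pp. 153–154.
* F. Golse, P.-L. Lions, B. Perthame, R. Sentis, J. Funct. Anal. 76 (1988) 110–125.
-/

noncomputable section

open MeasureTheory Set Metric Real Module
open scoped ENNReal InnerProductSpace

namespace Literature.MathematicalPhysics.KineticTheory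

/-! ### The one-dimensional integral -/

/-- `∫_ℝ dx / (1 + (c + κx)²) = π/|κ|` for `κ ≠ 0` (substitute `y = c + κx` in
`∫ dy/(1+y²) = π`). [folklore] -/
theorem lintegral_inv_one_add_sq_affine {κ : ℝ} (hκ : κ ≠ 0) (c : ℝ) :
    ∫⁻ x : ℝ, ENNReal.ofReal ((1 + (c + κ * x) ^ 2)⁻¹) = ENNReal.ofReal (π / |κ|) := by
  have hmeas : Measurable fun y : ℝ => ENNReal.ofReal ((1 + (c + y) ^ 2)⁻¹) :=
    ENNReal.measurable_ofReal.comp (by fun_prop)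
  have h1 : ∫⁻ x : ℝ, ENNReal.ofReal ((1 + (c + κ * x) ^ 2)⁻¹) =
      ∫⁻ y, ENNReal.ofReal ((1 + (c + y) ^ 2)⁻¹) ∂(Measure.map (fun x => κ * x) volume) := by
    rw [lintegral_map hmeas (measurable_const_mul κ)]
  have h2 : ∫⁻ y : ℝ, ENNReal.ofReal ((1 + (c + y) ^ 2)⁻¹) =
      ∫⁻ y : ℝ, ENNReal.ofReal ((1 + y ^ 2)⁻¹) :=
    lintegral_add_left_eq_self (μ := (volume : Measure ℝ))
      (fun y => ENNReal.ofReal ((1 + y ^ 2)⁻¹)) c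
  have h3 : ∫⁻ y : ℝ, ENNReal.ofReal ((1 + y ^ 2)⁻¹) = ENNReal.ofReal π := by
    rw [← ofReal_integral_eq_lintegral_ofReal integrable_inv_one_add_sq
      (ae_of_all _ fun x => by positivity), integral_univ_inv_one_add_sq]
  rw [h1, Real.map_volume_mul_left hκ, lintegral_smul_measure, h2, h3, smul_eq_mul,
    ← ENNReal.ofReal_mul (abs_nonneg _), abs_inv, div_eq_inv_mul]

variable {E : Type*} [NormedAddCommGroup E] [InnerProductSpace ℝ E] [FiniteDimensional ℝ E]
  [MeasurableSpace E] [BorelSpace E]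

/-! ### Integrating along the direction of `k` -/

/-- **Slab bound.** For `k ≠ 0`,
`∫_{B̄_R} dξ/(1 + (c + ⟪ξ,k⟫)²) ≤ (2R)^{d-1} π/‖k‖`, `d = dim E` (both sides vanish for `R < 0`): in an orthonormal basis with
`b₀ = k/‖k‖` the ball lies in the cube `[-R,R]^d`, the integrand depends on the `b₀`-coordinate
`x` only, through `1/(1+(c+‖k‖x)²)`, whose integral over `ℝ` is `π/‖k‖`
(CIP 1994, proof of Lemma 5.3.8, "consider first `τ₀ = 0, z₀ = (1,0,0)`"). [cite: CIP1994, §5.3 proof of Lemma 5.3.8 (3.33)] -/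
theorem setLIntegral_closedBall_inv_one_add_sq_inner_le (R c : ℝ) {k : E} (hk : k ≠ 0) :
    ∫⁻ ξ in closedBall (0 : E) R, ENNReal.ofReal ((1 + (c + ⟪ξ, k⟫_ℝ) ^ 2)⁻¹) ≤
      ENNReal.ofReal (2 * R) ^ (finrank ℝ E - 1) * ENNReal.ofReal (π / ‖k‖) := by
  haveI : Nontrivial E := nontrivial_of_ne k 0 hk
  obtain ⟨n, hn⟩ : ∃ n, finrank ℝ E = n + 1 := Nat.exists_eq_succ_of_ne_zero finrank_pos.ne'
  have hkn : 0 < ‖k‖ := norm_pos_iff.2 hk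
  -- an orthonormal basis whose first vector is `e = k/‖k‖`
  set e : E := ‖k‖⁻¹ • k with he
  have he1 : ‖e‖ = 1 := by
    rw [he, norm_smul, norm_inv, norm_norm, inv_mul_cancel₀ hkn.ne']
  set i₀ : Fin (n + 1) := 0 with hi₀
  have hv : Orthonormal ℝ (({i₀} : Set (Fin (n + 1))).restrict fun _ : Fin (n + 1) => e) := by
    refine ⟨fun i => by simpa using he1, fun i j hij => ?_⟩
    exact absurd (Subsingleton.elim i j) hij
  obtain ⟨b, hb⟩ := Orthonormal.exists_orthonormalBasis_extension_of_card_eq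
    (𝕜 := ℝ) (E := E) (by simp [hn]) hv
  have hbe : b i₀ = e := hb i₀ rfl
  -- the one-variable factor `F`, the cube `B` of the remaining coordinates, the product `G`
  set F : ℝ → ℝ≥0∞ :=
    (Icc (-R) R).indicator fun x => ENNReal.ofReal ((1 + (c + ‖k‖ * x) ^ 2)⁻¹) with hF
  set B : Set (Fin n → ℝ) := Set.pi univ fun _ => Icc (-R) R with hB
  have hBm : MeasurableSet B := MeasurableSet.univ_pi fun _ => measurableSet_Icc
  have hFm : Measurable F :=
    (ENNReal.measurable_ofReal.comp (by fun_prop)).indicator measurableSet_Icc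
  set G : ℝ × (Fin n → ℝ) → ℝ≥0∞ := fun p => F p.1 * B.indicator 1 p.2 with hG
  have hGm : Measurable G :=
    (hFm.comp measurable_fst).mul ((measurable_one.indicator hBm).comp measurable_snd)
  set sp := MeasurableEquiv.piFinSuccAbove (fun _ : Fin (n + 1) => ℝ) i₀ with hsp
  have hspm : MeasurePreserving sp volume volume := volume_preserving_piFinSuccAbove _ i₀
  have hφ : MeasurePreserving (fun ξ : E => WithLp.ofLp (b.repr ξ)) volume volume :=
    (PiLp.volume_preserving_ofLp (Fin (n + 1))).comp b.measurePreserving_repr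
  -- pointwise comparison of the integrand with `G` in the adapted coordinates
  have hpt : ∀ ξ : E,
      (closedBall (0 : E) R).indicator
          (fun ξ => ENNReal.ofReal ((1 + (c + ⟪ξ, k⟫_ℝ) ^ 2)⁻¹)) ξ ≤
        G (sp (WithLp.ofLp (b.repr ξ))) := by
    intro ξ
    by_cases hξ : ξ ∈ closedBall (0 : E) R
    · have hξR : ‖ξ‖ ≤ R := mem_closedBall_zero_iff.1 hξ
      have hcoord : ∀ i, b.repr ξ i ∈ Icc (-R) R := fun i => by
        rw [OrthonormalBasis.repr_apply_apply]
        have h := abs_real_inner_le_norm (b i) ξ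
        rw [b.orthonormal.1 i, one_mul] at h
        exact ⟨by linarith [neg_abs_le ⟪b i, ξ⟫_ℝ], by linarith [le_abs_self ⟪b i, ξ⟫_ℝ]⟩
      have hinner : ⟪ξ, k⟫_ℝ = ‖k‖ * b.repr ξ i₀ := by
        rw [OrthonormalBasis.repr_apply_apply, hbe, he, real_inner_smul_left, real_inner_comm,
          ← mul_assoc, mul_inv_cancel₀ hkn.ne', one_mul]
      have h1 : (sp (WithLp.ofLp (b.repr ξ))).1 = b.repr ξ i₀ := by
        simp [hsp]
      have h2 : (sp (WithLp.ofLp (b.repr ξ))).2 ∈ B := by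
        simp only [hB, mem_univ_pi]
        intro j
        simpa [hsp, Fin.removeNth] using hcoord (i₀.succAbove j)
      rw [indicator_of_mem hξ, hG]
      simp only
      rw [h1, indicator_of_mem h2, Pi.one_apply, mul_one, hF, indicator_of_mem (hcoord i₀),
        hinner]
    · rw [indicator_of_notMem hξ]
      exact zero_le
  -- the two factors
  have hF_le : ∫⁻ x, F x ≤ ENNReal.ofReal (π / ‖k‖) := by
    rw [hF, lintegral_indicator measurableSet_Icc]
    refine (setLIntegral_le_lintegral _ _).trans ?_
    rw [lintegral_inv_one_add_sq_affine hkn.ne' c, abs_of_pos hkn]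
  have hB_eq : ∫⁻ y, B.indicator (1 : (Fin n → ℝ) → ℝ≥0∞) y = ENNReal.ofReal (2 * R) ^ n := by
    rw [lintegral_indicator_one hBm, hB, volume_pi_pi]
    simp only [Real.volume_Icc, Finset.prod_const, Finset.card_univ, Fintype.card_fin]
    congr 2
    ring
  -- assembling
  have hdim : finrank ℝ E - 1 = n := by rw [hn, Nat.add_sub_cancel]
  calc ∫⁻ ξ in closedBall (0 : E) R, ENNReal.ofReal ((1 + (c + ⟪ξ, k⟫_ℝ) ^ 2)⁻¹)
      = ∫⁻ ξ, (closedBall (0 : E) R).indicator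
          (fun ξ => ENNReal.ofReal ((1 + (c + ⟪ξ, k⟫_ℝ) ^ 2)⁻¹)) ξ :=
        (lintegral_indicator measurableSet_closedBall _).symm
    _ ≤ ∫⁻ ξ, G (sp (WithLp.ofLp (b.repr ξ))) := lintegral_mono hpt
    _ = ∫⁻ w, G (sp w) := hφ.lintegral_comp (hGm.comp sp.measurable)
    _ = ∫⁻ p, G p := hspm.lintegral_comp hGm
    _ = (∫⁻ x, F x) * ∫⁻ y, B.indicator (1 : (Fin n → ℝ) → ℝ≥0∞) y := by
        rw [MeasureTheory.Measure.volume_eq_prod]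
        exact lintegral_prod_mul hFm.aemeasurable (measurable_one.indicator hBm).aemeasurable
    _ ≤ ENNReal.ofReal (π / ‖k‖) * ENNReal.ofReal (2 * R) ^ n := by
        rw [hB_eq]
        gcongr
    _ = ENNReal.ofReal (2 * R) ^ (finrank ℝ E - 1) * ENNReal.ofReal (π / ‖k‖) := by
        rw [hdim, mul_comm]

/-! ### The bound for all frequencies -/

omit [FiniteDimensional ℝ E] [MeasurableSpace E] [BorelSpace E] in
/-- Pointwise bound in the time-like regime: if `2R‖k‖ ≤ |c|`, `1 ≤ R` and `‖ξ‖ ≤ R`, then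
`1/(1 + (c + ⟪ξ,k⟫)²) ≤ 3/(1 + |c| + ‖k‖)` (there `|c + ⟪ξ,k⟫| ≥ |c|/2`). [folklore] -/
theorem inv_one_add_sq_inner_le_of_timelike {R c : ℝ} {k ξ : E} (hR : 1 ≤ R)
    (hck : 2 * R * ‖k‖ ≤ |c|) (hξ : ‖ξ‖ ≤ R) :
    (1 + (c + ⟪ξ, k⟫_ℝ) ^ 2)⁻¹ ≤ 3 / (1 + |c| + ‖k‖) := by
  have hk0 : 0 ≤ ‖k‖ := norm_nonneg k
  have hin : |⟪ξ, k⟫_ℝ| ≤ |c| / 2 := by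
    calc |⟪ξ, k⟫_ℝ| ≤ ‖ξ‖ * ‖k‖ := abs_real_inner_le_norm ξ k
      _ ≤ R * ‖k‖ := by gcongr
      _ ≤ |c| / 2 := by linarith
  have hsq : c ^ 2 / 4 ≤ (c + ⟪ξ, k⟫_ℝ) ^ 2 := by
    have h1 : |c| / 2 ≤ |c + ⟪ξ, k⟫_ℝ| := by
      have := abs_add_le c ⟪ξ, k⟫_ℝ
      have h2 : |c| - |⟪ξ, k⟫_ℝ| ≤ |c + ⟪ξ, k⟫_ℝ| := by
        have := abs_sub_abs_le_abs_sub c (-⟪ξ, k⟫_ℝ)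
        rw [abs_neg, sub_neg_eq_add] at this
        exact this
      linarith
    have h0 : 0 ≤ |c| / 2 := by positivity
    calc c ^ 2 / 4 = (|c| / 2) ^ 2 := by rw [div_pow, sq_abs]; norm_num
      _ ≤ |c + ⟪ξ, k⟫_ℝ| ^ 2 := pow_le_pow_left₀ h0 h1 2
      _ = (c + ⟪ξ, k⟫_ℝ) ^ 2 := sq_abs _
  have hkc : ‖k‖ ≤ |c| / 2 := by
    have : 2 * ‖k‖ ≤ 2 * R * ‖k‖ := by nlinarith
    linarith
  have hpos : 0 < 1 + |c| + ‖k‖ := by positivity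
  have hpos' : 0 < 1 + (c + ⟪ξ, k⟫_ℝ) ^ 2 := by positivity
  rw [inv_eq_one_div, div_le_div_iff₀ hpos' hpos]
  have habs : |c| ^ 2 = c ^ 2 := sq_abs c
  nlinarith [abs_nonneg c, sq_nonneg (|c| - 1)]

omit [FiniteDimensional ℝ E] [MeasurableSpace E] [BorelSpace E] in
/-- `1/(1 + (c + ⟪ξ,k⟫)²) ≤ 1`. [folklore] -/
theorem inv_one_add_sq_inner_le_one (c : ℝ) (k ξ : E) : (1 + (c + ⟪ξ, k⟫_ℝ) ^ 2)⁻¹ ≤ 1 :=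
  inv_le_one_of_one_le₀ (by nlinarith [sq_nonneg (c + ⟪ξ, k⟫_ℝ)])

/-- **The slab integral bound** (CIP 1994, proof of Lemma 5.3.8, pp. 153–154, resolvent form):
for every radius `R` there is `C ≥ 0` such that for all `c ∈ ℝ` and `k ∈ E`,
`∫_{B̄_R(0)} dξ / (1 + (c + ⟪ξ, k⟫)²) ≤ C / (1 + |c| + ‖k‖)`. [cite: CIP1994, §5.3 proof of Lemma 5.3.8 (3.33)] -/
theorem exists_setLIntegral_closedBall_inv_one_add_sq_inner_le (R : ℝ) :
    ∃ C : ℝ, 0 ≤ C ∧ ∀ (c : ℝ) (k : E),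
      ∫⁻ ξ in closedBall (0 : E) R, ENNReal.ofReal ((1 + (c + ⟪ξ, k⟫_ℝ) ^ 2)⁻¹) ≤
        ENNReal.ofReal (C / (1 + |c| + ‖k‖)) := by
  set R' : ℝ := max R 1 with hR'
  have hR'1 : 1 ≤ R' := le_max_right _ _
  have hRR' : R ≤ R' := le_max_left _ _
  have hvol : volume (closedBall (0 : E) R') ≠ ∞ := (isCompact_closedBall (0 : E) R').measure_lt_top.ne
  set V₀ : ℝ := (volume (closedBall (0 : E) R')).toReal with hV₀
  have hV₀0 : 0 ≤ V₀ := ENNReal.toReal_nonneg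
  have hV₀e : ENNReal.ofReal V₀ = volume (closedBall (0 : E) R') := ENNReal.ofReal_toReal hvol
  set D : ℝ := (2 * R') ^ (finrank ℝ E - 1) * π with hD
  have hD0 : 0 ≤ D := by positivity
  refine ⟨3 * V₀ + (2 * R' + 2) * V₀ + (2 * R' + 2) * D, by positivity, fun c k => ?_⟩
  have hpos : 0 < 1 + |c| + ‖k‖ := by positivity
  -- enlarge the ball to radius `R' ≥ 1`
  refine (lintegral_mono_set (closedBall_subset_closedBall hRR')).trans ?_
  have hmeas : Measurable fun ξ : E => ENNReal.ofReal ((1 + (c + ⟪ξ, k⟫_ℝ) ^ 2)⁻¹) :=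
    ENNReal.measurable_ofReal.comp (by fun_prop)
  rcases le_or_gt (2 * R' * ‖k‖) |c| with hck | hck
  · -- time-like: pointwise bound `3/(1+|c|+‖k‖)`
    calc ∫⁻ ξ in closedBall (0 : E) R', ENNReal.ofReal ((1 + (c + ⟪ξ, k⟫_ℝ) ^ 2)⁻¹)
        ≤ ∫⁻ _ in closedBall (0 : E) R', ENNReal.ofReal (3 / (1 + |c| + ‖k‖)) := by
          refine setLIntegral_mono measurable_const fun ξ hξ => ?_
          exact ENNReal.ofReal_le_ofReal
            (inv_one_add_sq_inner_le_of_timelike hR'1 hck (mem_closedBall_zero_iff.1 hξ))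
      _ = ENNReal.ofReal (3 / (1 + |c| + ‖k‖) * V₀) := by
          rw [setLIntegral_const, ← hV₀e, ← ENNReal.ofReal_mul (by positivity)]
      _ ≤ _ := by
          refine ENNReal.ofReal_le_ofReal ?_
          rw [div_mul_eq_mul_div, div_le_div_iff_of_pos_right hpos]
          nlinarith
  · have hkn : 0 < ‖k‖ := by
      by_contra h
      have h0 : ‖k‖ = 0 := le_antisymm (not_lt.1 h) (norm_nonneg _)
      rw [h0, mul_zero] at hck
      exact (abs_nonneg c).not_gt hck
    have hk : k ≠ 0 := norm_pos_iff.1 hkn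
    rcases le_or_gt ‖k‖ 1 with hk1 | hk1
    · -- small `k` (hence small `c`): the trivial bound `V₀`
      calc ∫⁻ ξ in closedBall (0 : E) R', ENNReal.ofReal ((1 + (c + ⟪ξ, k⟫_ℝ) ^ 2)⁻¹)
          ≤ ∫⁻ _ in closedBall (0 : E) R', 1 := by
            refine setLIntegral_mono measurable_const fun ξ _ => ?_
            rw [← ENNReal.ofReal_one]
            exact ENNReal.ofReal_le_ofReal (inv_one_add_sq_inner_le_one c k ξ)
        _ = ENNReal.ofReal V₀ := by rw [setLIntegral_one, hV₀e]
        _ ≤ _ := by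
            refine ENNReal.ofReal_le_ofReal ?_
            rw [le_div_iff₀ hpos]
            have h1 : 1 + |c| + ‖k‖ ≤ 2 * R' + 2 := by nlinarith
            nlinarith
    · -- large `k`: the slab bound
      calc ∫⁻ ξ in closedBall (0 : E) R', ENNReal.ofReal ((1 + (c + ⟪ξ, k⟫_ℝ) ^ 2)⁻¹)
          ≤ ENNReal.ofReal (2 * R') ^ (finrank ℝ E - 1) * ENNReal.ofReal (π / ‖k‖) :=
            setLIntegral_closedBall_inv_one_add_sq_inner_le R' c hk
        _ = ENNReal.ofReal (D / ‖k‖) := by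
            rw [← ENNReal.ofReal_pow (by positivity), ← ENNReal.ofReal_mul (by positivity), hD,
              mul_div_assoc]
        _ ≤ _ := by
            refine ENNReal.ofReal_le_ofReal ?_
            rw [div_le_div_iff₀ hkn hpos]
            have h1 : 1 + |c| + ‖k‖ ≤ (2 * R' + 2) * ‖k‖ := by nlinarith
            have h2 : D * (1 + |c| + ‖k‖) ≤ D * ((2 * R' + 2) * ‖k‖) :=
              mul_le_mul_of_nonneg_left h1 hD0
            nlinarith

end Literature.MathematicalPhysics.KineticTheory
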